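import Mathlib
import Literature.NumberTheory.Automorphic.SolvableBaseChangeModularityProofs
import Literature.NumberTheory.Automorphic.TotallyRealModularity
import Literature.NumberTheory.EllipticCurves.IsogenyHasCMProofs
import HarnessLib

/-!
# RealQuadraticJInvariantModularity

Topic `Literature/NumberTheory/Automorphic`. Named literature fact(s) relocated by the gate from `Summits/Langlands/Langlands/Theorems/SqrtFiveQuarticCoversJInSqrtFiveModular.lean`
(accept-time relocation of `[cite]`d propositions written inline in a Summits proposal; human ruling 2026-08-15).
Sources: Box2022, FreitasLeHungSiksek2015, Langlands1980AMS96, Thorne2016.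

* `Literature.NumberTheory.Automorphic.isModularEllipticCurve_baseChange_of_isSolvable_of_isAutomorphicOfWeightZero`
-/

namespace Literature.NumberTheory.Automorphic

open scoped NumberField Polynomial IntermediateField
open NumberField Polynomial Literature.NumberTheory.Automorphic

/-- **Soluble base change of modularity for elliptic curves over a totally real field (Thorne
2016, Lemma 7.1; Langlands 1980; as used by Freitas–Le Hung–Siksek 2015 and Box 2022).**
Printed (Thorne, Lemma 7.1): "Let `F` be a totally real number field, and `F′/F` a soluble totally
real extension. … Let `π` be a cuspidal automorphic representation of `GL₂(𝔸_F)` of weight `2`,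
and suppose that `r_ι(π)|_{G_{F′}}` is irreducible. Then there exists a cuspidal automorphic
representation `π_{F′}` of `GL₂(𝔸_{F′})` of weight `2`, called the base change of `π`, such that
`r_ι(π_{F′}) ≅ r_ι(π)|_{G_{F′}}`."  Rendered on the tree's carrier for elliptic curves, exactly as
the `F = ℚ` instance `isModularEllipticCurve_baseChange_rat_of_isSolvable`: for `F` totally real,
`K / F` finite Galois with solvable group and `K` totally real, and `E₀ / 𝓞 F` with `Δ(E₀) ≠ 0`
that is modular in the strong sense `IsAutomorphicOfWeightZero E₀` (a weight-zero cuspidal `π` of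
`GL₂(𝔸_F)` with Hecke polynomial `X² − a_w(E₀)X + q_w` at every `w ∤ Δ`), the base change
`E₀ ⊗ 𝓞 K` is modular (`IsModularEllipticCurve K`, the cofinite Caraiani–Newton cone): apply the
lemma to `π = π(E₀)` (`r_ι(π) ≅ ρ_{E₀,p}`; its restriction to `G_K` is irreducible because a CM
field of `E₀` is imaginary while `K` is totally real), or, if `E₀` has CM, use the first
alternative of the cone.  WEAKER than print (conclusion cofinite and trace-only).  A named fact
(D-0014): users take `(h : isModularEllipticCurve_baseChange_of_isSolvable_of_isAutomorphicOfWeightZero)`.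
-- TODO(general form): the `π`-level statement (Hilbert cusp forms of parallel weight `2`, any
-- soluble totally real `F′/F`), whose Galois-side version is `ACC2023.solubleBaseChange_isAutomorphic`.
[cite: Thorne2016, Lemma 7.1] [cite: Langlands1980AMS96, Ch. 2, pp. 10–13]
[cite: FreitasLeHungSiksek2015, proof of Thm. 7 (p. 14) and §5 (p. 33)] [cite: Box2022, §1.2 (p. 5)]
[file NumberTheory/Automorphic/RealQuadraticJInvariantModularity] -/
def isModularEllipticCurve_baseChange_of_isSolvable_of_isAutomorphicOfWeightZero : Prop :=
  ∀ (F : Type) [Field F] [NumberField F] [NumberField.IsTotallyReal F]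
    (K : Type) [Field K] [NumberField K] [NumberField.IsTotallyReal K] [Algebra F K] [IsGalois F K]
    [IsSolvable (K ≃ₐ[F] K)] (E₀ : WeierstrassCurve (NumberField.RingOfIntegers F)), E₀.Δ ≠ 0 →
      Literature.NumberTheory.Automorphic.IsAutomorphicOfWeightZero E₀ →
        Literature.NumberTheory.Automorphic.IsModularEllipticCurve K
          (E₀.baseChange (NumberField.RingOfIntegers K))

/-! ### The integral model of prescribed `j`-invariant `p / q` over a commutative ring -/

end Literature.NumberTheory.Automorphic
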